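import Summits.QuantumFields.YangMills.Theorems.UnitScaleTiltProp8FlatHScaledExtension
import Summits.QuantumFields.YangMills.Theorems.UnitScaleTiltProp8ChartDoubleBarDeriv
import HarnessLib

/-!
# Route `UnitScaleTilt`, crux K1 «MinimiserStabilityRegPr» (stmt-QuantumFields-19200), stub V2′ `stub_halvingStep` (H), RULING g26-№11 (i) «`H := Hs` of record»:
# **`Hs` IS A RIGHT INVERSE OF THE LINEARISED DOUBLE-BAR CHART — `fderiv ℂ (chartLogFlat η D) 0 (Hs X) = X`** (the `hHinv` binder of
# `Chart47AnalyticCarrier.exists_analytic_chartD_of_remainder_T3` for the (S5) inhabitant, by (S1b) CERT-2)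

Cell `ym3-torus` (HUMAN RULING D-0037: YM ladder rung R3 — not the Clay problem), width seat `ym-ust-19200-w3` gen 4.  `--supports stmt-QuantumFields-19200 --as helper`;
def-free, 0 sorry.  Three lines of bookkeeping: ✓`FlatHDressingShape.exists_flatH_scaledExt` (ii) `(L^{j(c)}η)•Q_{j(c)}(Hs X)(c) = X c` (real scalar) + ✓p611330
`Prop8ChartDoubleBar.fderiv_chartLogFlat_zero_apply` (`DQ♭(0) Y (j,c) = (η·Lʲ : ℂ)•Q_j Y c`) + the real∕complex scalar identification on matrices.

WHAT THIS FILE PROVES: `coe_real_smul_matrix` (`((r : ℝ) : ℂ) • M = r • M`), ★★ `exists_flatH_scaledExt_hHinv` — the (S5) `∃ Hs` package with its identity clause in the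
`fderiv` form the (S6) `obtain` consumes (`hHinv`), next to the kernel formula and BOTH (46) rows (`hHB` and the gradient row), for EVERY nested family `D` with
`D.k = K − n`-free statement (only the weights' `IsLevWeight` and P2's `HSupLetterG` for `flatH` are used).
HONEST SCOPE: bookkeeping; NOT a claim about the stub, the crux, the rung or the mass gap.

References: T. Bałaban, CMP **102** (1985) 277–309 [Balaban1985Variational] ((44)–(46) p.285, (157) p.302); CMP **98** (1985) 17–51 [Balaban1985Averaging] ((125) p.36).
-/

set_option autoImplicit false

noncomputable section

open scoped BigOperators Matrix.Norms.L2Operator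

namespace Summit.QuantumFields.YangMills.Theorems.FlatHDressingShape

open Literature.MathematicalPhysics.QuantumFieldTheory.Balaban1983to89
open LatticeFieldCalculus (bondAvgIter)
open B6SectADomainsV1 (Domains)
open B6SectAOperatorsV1 (BondIdx)
open T3ContinuumYM3Torus (T3Family)
open Summit.QuantumFields.YangMills.Theorems.FlatCubeOpsText (IsLevWeight HSupLetterG)
open Summit.QuantumFields.YangMills.Theorems.FlatOpsLettersAssembly (flatH)
open Summit.QuantumFields.YangMills.Theorems.Prop8ChartDoubleBar (chartLogFlat fderiv_chartLogFlat_zero_apply)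

/-- The real and the complex scalar actions on complex matrices agree along `ℝ → ℂ`: `((r : ℝ) : ℂ) • M = r • M`. [folklore] -/
theorem coe_real_smul_matrix (r : ℝ) (M : Matrix (Fin 2) (Fin 2) ℂ) : ((r : ℂ)) • M = r • M := by
  ext i j
  simp [Matrix.smul_apply, Complex.real_smul]

variable (F : T3Family) (n K : ℕ) (D : Domains (F.P K))

/-- **THE (S5) INHABITANT WITH ITS `hHinv` IN `fderiv` FORM**: a ℂ-linear `Hs` with the kernel formula `Hs X b = Σ_c ((flatH e_c)(b)·(L^{j(c)}η)⁻¹) • X c`,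
`fderiv ℂ (chartLogFlat η D) 0 (Hs X) = X` (`η = L^{−(K−n)}`; CERT-2 + (45)), and both (46) rows at P2's `B₀` for unweighted data, unguarded.
[cite: Balaban1985Variational, (44)-(46) p.285, (157) p.302; Balaban1985Averaging, (125) p.36] -/
theorem exists_flatH_scaledExt_hHinv (w : ℕ → PBond (F.P K) 0 → ℝ) (hw : IsLevWeight F n K D w) {B₀ : ℝ}
    (hsup : HSupLetterG F n K D w (flatH F n K D) B₀) :
    ∃ Hs : (BondIdx D → Matrix (Fin 2) (Fin 2) ℂ) →ₗ[ℂ] (PBond (F.P K) 0 → Matrix (Fin 2) (Fin 2) ℂ),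
      (∀ X b, Hs X b = ∑ c, (flatH F n K D (Pi.single c 1) b * ((F.L : ℝ) ^ (c.1.1 : ℕ) * ((F.L : ℝ)⁻¹) ^ (K - n))⁻¹) • X c) ∧
      (∀ X, (fderiv ℂ (chartLogFlat (((F.L : ℝ)⁻¹) ^ (K - n)) D :
          (PBond (F.P K) 0 → Matrix (Fin 2) (Fin 2) ℂ) → BondIdx D → Matrix (Fin 2) (Fin 2) ℂ) 0) (Hs X) = X) ∧
      (∀ (X : BondIdx D → Matrix (Fin 2) (Fin 2) ℂ) (t : ℝ), (∀ c, ‖X c‖ ≤ t) → ∀ b, w 1 b * ‖Hs X b‖ ≤ B₀ * t) ∧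
      ∀ (X : BondIdx D → Matrix (Fin 2) (Fin 2) ℂ) (t : ℝ), (∀ c, ‖X c‖ ≤ t) → ∀ (b : PBond (F.P K) 0) (ν : Fin 3),
        w 2 b * (F.L : ℝ) ^ (K - n) * ‖Hs X ⟨b.src.shift ν, b.dir⟩ - Hs X b‖ ≤ B₀ * t := by
  obtain ⟨Hs, hform, hinv, hsupRow, hgradRow⟩ := exists_flatH_scaledExt F n K D w hw hsup
  refine ⟨Hs, hform, fun X => funext fun idx => ?_, hsupRow, hgradRow⟩
  rw [fderiv_chartLogFlat_zero_apply]
  have hscal : ((((F.L : ℝ)⁻¹) ^ (K - n) : ℝ) : ℂ) * (((F.P K).L : ℕ) : ℂ) ^ (idx.1.1 : ℕ) =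
      (((F.L : ℝ) ^ (idx.1.1 : ℕ) * ((F.L : ℝ)⁻¹) ^ (K - n) : ℝ) : ℂ) := by
    have hL : (((F.P K).L : ℕ) : ℂ) = ((F.L : ℝ) : ℂ) := by norm_cast
    rw [hL]; push_cast; ring
  rw [hscal, coe_real_smul_matrix]
  exact hinv X idx

end Summit.QuantumFields.YangMills.Theorems.FlatHDressingShape

end
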